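import Literature.AlgebraicGeometry.Resolution.Prop81MiddleAssembly
import Literature.AlgebraicGeometry.Resolution.Prop81PreStage
import Literature.AlgebraicGeometry.Resolution.ModelDenominatorTracking
import Literature.AlgebraicGeometry.Resolution.ValueGroupRankData
import HarnessLib

/-!
# [CoP1] Prop. 8.1 ⇒ head of Prop. 9.3, modulo monomialization WITH denominator control

Topic: `Literature/AlgebraicGeometry/Resolution`. PROOF side of `CossartPiltant2019ReductionP`
(`ArithmeticalThreefoldsLocal.lean`), input (C4): the head `hHead` of
`cossartPiltant2019ReductionP_of_cjs_of_stableInertia_of_head`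
(`ArithmeticalThreefoldsLocalDescentDecompositionHead.lean`). This file PROVES the conclusion
of `hHead` (for given `t₁, t₁′`) from ONE remaining hypothesis `hMono` — the model form of
[CoP1] Prop. 4.1 for one element along the valuation ("there exists a local uniformization
`S₂` … `(S₁)_f = (S₂)_f` and `f S₂` is monomial", HAL hal-00139124, p. 22) WITH THE
DENOMINATOR CLAUSE of `ModelDenominatorTracking.lean`: the new generators are `β/α` with
`α, β` in the old local ring and `α ∣ G^M` in the new one (what the embedded resolution of
`V(G)`, an isomorphism off `V(G)`, provides: exceptional prime divisors of the new local
uniformization lie over `V(G)`). Everything else is assembled from the tree: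
`exists_preStage` (Cor. 4.6 and the principalization of `m_{R₁′}`), `exists_rank_data`
(the choice (46)), `exists_model_tracked_of_denominators_subset` (property (1)),
and `head_conclusion_of_principalized` (the monoidal loops and the extraction):
`head_conclusion_of_monomialization`.

Everything is PROVED; no named facts, definitions, instances or notation are introduced
(`hMono`, `CossartPiltant2019Principalization` and `hEmb` are hypotheses, as in the chain).

## Sources

* V. Cossart, O. Piltant, J. Algebra 320 (2008) 1051–1082: Prop. 8.1 and its proof, proof of
  Prop. 9.3 (HAL hal-00139124, pp. 22–23, 27–28). [CossartPiltant2008]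
-/

noncomputable section

open AlgebraicGeometry CategoryTheory

namespace Literature.AlgebraicGeometry.Resolution

universe u

open IsLocalRing _root_.Polynomial Function

section HeadOfGlue

variable {S : Type u} [CommRing S] [IsRegularLocalRing S] {E : Type u} [Field E] [Algebra S E]
  [Algebra.IsAlgebraic S E]

set_option maxHeartbeats 400000 in
omit [IsRegularLocalRing S] [Algebra.IsAlgebraic S E] in
/-- Transport of a regular system of parameters along an equality of local rings of models
(private copy of the one in `MonoidalTransformFrameStepTracked.lean`). [folklore] -/
private theorem transport_rsop' (OE : ValuationSubring E) {t₁ t₂ : Set E}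
    (h₁ : (Algebra.adjoin S t₁).toSubring ≤ OE.toSubring)
    (h₂ : (Algebra.adjoin S t₂).toSubring ≤ OE.toSubring)
    (hEq : locAtCentre (Algebra.adjoin S t₁).toSubring OE =
      locAtCentre (Algebra.adjoin S t₂).toSubring OE)
    {d : ℕ} (x' : Fin d → locAtCentre (Algebra.adjoin S t₁).toSubring OE)
    (hspan : haveI := isLocalRing_locAtCentre h₁
      Ideal.span (Set.range x') = maximalIdeal _) :
    ∃ x'' : Fin d → locAtCentre (Algebra.adjoin S t₂).toSubring OE,
      (∀ c, (x'' c : E) = (x' c : E)) ∧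
      (haveI := isLocalRing_locAtCentre h₂
       Ideal.span (Set.range x'') = maximalIdeal _) := by
  haveI := isLocalRing_locAtCentre h₁
  haveI := isLocalRing_locAtCentre h₂
  let e : locAtCentre (Algebra.adjoin S t₁).toSubring OE ≃+*
      locAtCentre (Algebra.adjoin S t₂).toSubring OE :=
    { toFun := fun w => ⟨(w : E), hEq ▸ w.2⟩
      invFun := fun w => ⟨(w : E), hEq.symm ▸ w.2⟩
      left_inv := fun _ => rfl
      right_inv := fun _ => rfl
      map_mul' := fun _ _ => rfl
      map_add' := fun _ _ => rfl }
  refine ⟨fun c => e (x' c), fun c => rfl, ?_⟩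
  have hmap : (Ideal.span (Set.range x')).map e.toRingHom =
      Ideal.span (Set.range fun c => e (x' c)) := by
    rw [Ideal.map_span, ← Set.range_comp]
    rfl
  rw [← hmap, hspan]
  refine le_antisymm (fun y hy => ?_) (fun y hy => ?_)
  · obtain ⟨w, hw, rfl⟩ := (Ideal.mem_map_iff_of_surjective e.toRingHom e.surjective).mp hy
    rw [mem_maximalIdeal_locAtCentre_iff h₂]
    exact (mem_maximalIdeal_locAtCentre_iff h₁ w).mp hw
  · have hvy : OE.valuation (y : E) < 1 := (mem_maximalIdeal_locAtCentre_iff h₂ y).mp hy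
    have : y = e.toRingHom (e.symm y) := (e.apply_symm_apply y).symm
    rw [this]
    exact Ideal.mem_map_of_mem _ ((mem_maximalIdeal_locAtCentre_iff h₁ _).mpr hvy)

set_option maxHeartbeats 3200000 in
/-- **The head of [CoP1] Prop. 9.3 from monomialization with denominator control.** In the
frame of `hHead` (for given `t₁, t₁′`), assuming `CossartPiltant2019Principalization`, the
embedded-resolution hypothesis `hEmb` of the chain, and `hMono` — monomialization of one
element `G` of a local uniformization `R_t` of `K′` in a finer one `R_{t′}`, `t ⊆ t′ ⊆ K′`,
whose generators are quotients `β/α` of elements of `R_t` with `α ∣ G^N` in `R_{t′}` — the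
conclusion of `hHead` holds. Proof = [CoP1] pp. 22–23 and 27: pre-stage (`exists_preStage`),
choice (46) (`exists_rank_data`), `G := q · h₀ · ∏ fᵢ`, monomialization (`hMono`), property (1)
(`exists_model_tracked_of_denominators_subset`), `F := q′ G`, and
`head_conclusion_of_principalized`.
[cite: CossartPiltant2008, Prop. 8.1 and proof of Prop. 9.3 (HAL pp. 22–23, 27)] -/
theorem head_conclusion_of_monomialization (h44 : CossartPiltant2019Principalization.{u})
    (hEmb : ∀ (Z : Scheme.{u}) [IsIntegral Z] [IsNoetherian Z], Scheme.IsRegular Z →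
      Scheme.IsExcellent Z → ∀ (X : Set Z), IsClosed X → X ≠ Set.univ → topologicalKrullDim X ≤ 2 →
        ∃ (Z' : Scheme.{u}) (π : Z' ⟶ Z), IsProper π ∧ Function.Surjective π.base ∧
          (∃ U : Z.Opens, (U : Set Z) = Xᶜ ∧ IsIso (π ∣_ U)) ∧
          IsStrictNormalCrossingsDivisor Z' (π.base ⁻¹' X))
    (hS : IsExcellentRing S) (hSdim : ringKrullDim S = 3)
    (hinj : Function.Injective (algebraMap S E))
    (OE : ValuationSubring E) (hSO : ∀ s : S, algebraMap S E s ∈ OE)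
    (hdom : ∀ s ∈ maximalIdeal S, OE.valuation (algebraMap S E s) < 1)
    (hres : ∀ y : OE, ∃ q : S[X], (∃ i, q.coeff i ∉ maximalIdeal S) ∧
      OE.valuation (q.eval₂ (algebraMap S E) y) < 1)
    (hrk : Nonempty OE.valuation.RankOne)
    (M K' : Subfield E) (hSM : ∀ s : S, algebraMap S E s ∈ M) (hMK' : M ≤ K')
    (hLUK' : ∃ t : Finset E, (t : Set E) ⊆ K' ∧
      K' ≤ Subfield.closure (Set.range (algebraMap S E) ∪ (t : Set E)) ∧
      ∃ hTO : (Algebra.adjoin S (t : Set E)).toSubring ≤ OE.toSubring,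
        IsRegularLocalRing (Localization.AtPrime
          (Ideal.comap (Subring.inclusion hTO) (maximalIdeal OE))))
    (t₁ : Finset E) (ht₁M : (t₁ : Set E) ⊆ M)
    (ht₁O : (Algebra.adjoin S (t₁ : Set E)).toSubring ≤ OE.toSubring)
    (t₁' : Finset E) (ht₁'K : (t₁' : Set E) ⊆ K')
    (hext : ∀ x : E, x ∈ K' → (IsIntegral (Algebra.adjoin S (t₁ : Set E)) x ↔
      x ∈ Algebra.adjoin S ((t₁ : Set E) ∪ (t₁' : Set E))))
    (hMono : ∀ (t : Finset E), (t : Set E) ⊆ K' →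
      ∀ hTO : (Algebra.adjoin S (t : Set E)).toSubring ≤ OE.toSubring,
      IsRegularLocalRing (locAtCentre (Algebra.adjoin S (t : Set E)).toSubring OE) →
      ∀ G : E, G ∈ locAtCentre (Algebra.adjoin S (t : Set E)).toSubring OE → G ≠ 0 →
        OE.valuation G < 1 →
      ∃ t' : Finset E, t ⊆ t' ∧ (t' : Set E) ⊆ K' ∧
        ∃ hT'O : (Algebra.adjoin S (t' : Set E)).toSubring ≤ OE.toSubring,
        IsRegularLocalRing (locAtCentre (Algebra.adjoin S (t' : Set E)).toSubring OE) ∧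
        ∃ (x : Fin 3 → locAtCentre (Algebra.adjoin S (t' : Set E)).toSubring OE) (u : E)
          (α : Fin 3 → ℕ),
          (haveI := isLocalRing_locAtCentre hT'O
           Ideal.span (Set.range x) = maximalIdeal _) ∧
          u ∈ locAtCentre (Algebra.adjoin S (t' : Set E)).toSubring OE ∧ OE.valuation u = 1 ∧
          G = u * ∏ c, (x c : E) ^ α c ∧
          ∀ z ∈ (t' : Set E), ∃ a b : E,
            a ∈ locAtCentre (Algebra.adjoin S (t : Set E)).toSubring OE ∧
            b ∈ locAtCentre (Algebra.adjoin S (t : Set E)).toSubring OE ∧ a ≠ 0 ∧ z * a = b ∧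
            ∃ (N : ℕ) (c : E), c ∈ locAtCentre (Algebra.adjoin S (t' : Set E)).toSubring OE ∧
              G ^ N = a * c) :
    ∃ (t' : Finset E) (_ : (t' : Set E) ⊆ K')
      (hTO' : (Algebra.adjoin S (t' : Set E)).toSubring ≤ OE.toSubring)
      (_ : Algebra.adjoin S ((t₁ : Set E) ∪ (t₁' : Set E)) ≤ Algebra.adjoin S (t' : Set E))
      (_ : IsRegularLocalRing (locAtCentre (Algebra.adjoin S (t' : Set E)).toSubring OE))
      (r : ℕ) (hr : r ≤ 3) (_ : 0 < r)
      (x : Fin 3 → locAtCentre (Algebra.adjoin S (t' : Set E)).toSubring OE),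
      (∀ j, ((x j : locAtCentre (Algebra.adjoin S (t' : Set E)).toSubring OE) : E) ≠ 0) ∧
      (haveI := isLocalRing_locAtCentre hTO'
       Ideal.span (Set.range x) =
         maximalIdeal (locAtCentre (Algebra.adjoin S (t' : Set E)).toSubring OE)) ∧
      (∀ y : locAtCentre (Algebra.adjoin S (t' : Set E)).toSubring OE,
        (y : E) ∈ locAtCentre (Algebra.adjoin S ((t₁ : Set E) ∪ (t₁' : Set E))).toSubring OE →
        OE.valuation (y : E) < 1 →
        y ∈ Ideal.span {∏ i : Fin r, x (Fin.castLE hr i)}) ∧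
      (∃ (f : Fin r → E) (γ : Fin r → (locAtCentre (Algebra.adjoin S (t' : Set E)).toSubring OE)ˣ)
          (a : Matrix (Fin r) (Fin r) ℕ),
        (∀ i, f i ∈ M) ∧
        (∀ i, f i = ((γ i : locAtCentre (Algebra.adjoin S (t' : Set E)).toSubring OE) : E) *
          ∏ j, ((x (Fin.castLE hr j) :
            locAtCentre (Algebra.adjoin S (t' : Set E)).toSubring OE) : E) ^ a i j) ∧
        (a.map (fun n : ℕ => (n : ℤ))).det ≠ 0) ∧
      (∃ (f₁ : E) (w : (locAtCentre (Algebra.adjoin S (t' : Set E)).toSubring OE)ˣ)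
          (e : Fin r → ℕ),
        f₁ ∈ locAtCentre (Algebra.adjoin S ((t₁ : Set E) ∪ (t₁' : Set E))).toSubring OE ∧
        f₁ = ((w : locAtCentre (Algebra.adjoin S (t' : Set E)).toSubring OE) : E) *
          ∏ i, ((x (Fin.castLE hr i) :
            locAtCentre (Algebra.adjoin S (t' : Set E)).toSubring OE) : E) ^ e i ∧
        ∀ z ∈ (t' : Set E), ∃ n : ℕ,
          f₁ ^ n * z ∈
            locAtCentre (Algebra.adjoin S ((t₁ : Set E) ∪ (t₁' : Set E))).toSubring OE) := by
  classical
  haveI : IsDomain S := isDomain_of_isRegularLocalRing S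
  have hSdim' : ringKrullDim S = (3 : ℕ) := by rw [hSdim]; norm_cast
  have hSuc : IsUniversallyCatenaryRing S := hS.isUniversallyCatenaryRing
  have hSK : ∀ s : S, algebraMap S E s ∈ K' := fun s => hMK' (hSM s)
  set B₀ : Subalgebra S E := Algebra.adjoin S ((t₁ : Set E) ∪ (t₁' : Set E)) with hB₀def
  set A : Subring E := locAtCentre B₀.toSubring OE with hAdef
  have hsA : ∀ s : S, algebraMap S E s ∈ A := fun s => le_locAtCentre _ _ (B₀.algebraMap_mem s)
  -- pre-stage and rank data
  obtain ⟨t, htK, hB₀t, hTO, hreg, hAR, ⟨q, hqB, hq0, hqt⟩, ⟨h₀, hh₀B, hh₀0, hvh₀, hdom₀⟩⟩ :=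
    exists_preStage h44 hS hSdim hinj OE hSO hdom hres M K' hSM hMK' hLUK' t₁ ht₁M ht₁O t₁' ht₁'K
      hext
  obtain ⟨r, s, hr0, -, hs0, hind, -, hdep⟩ := exists_rank_data hEmb hS hSdim hinj OE hSO hdom hres
  have hB₀O : B₀.toSubring ≤ OE.toSubring := fun y hy => hTO (hB₀t hy)
  have hAO : A ≤ OE.toSubring := locAtCentre_le hB₀O
  have hsE0 : ∀ i, algebraMap S E (s i) ≠ 0 := fun i h => hs0 i (hinj (by rw [h, map_zero]))
  -- the element to monomialize
  set G : E := q * h₀ * ∏ i, algebraMap S E (s i) with hGdef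
  have hGB : G ∈ B₀ := Subalgebra.mul_mem _ (Subalgebra.mul_mem _ hqB hh₀B)
    (Subalgebra.prod_mem _ fun i _ => B₀.algebraMap_mem _)
  have hGA : G ∈ A := le_locAtCentre _ _ hGB
  have hGR : G ∈ locAtCentre (Algebra.adjoin S (t : Set E)).toSubring OE := hAR hGA
  have hG0 : G ≠ 0 := mul_ne_zero (mul_ne_zero hq0 hh₀0)
    (Finset.prod_ne_zero_iff.mpr fun i _ => hsE0 i)
  have hvG : OE.valuation G < 1 := by
    have h1 : OE.valuation (q * ∏ i, algebraMap S E (s i)) ≤ 1 :=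
      (OE.valuation_le_one_iff _).mpr (OE.mul_mem _ _ (hB₀O hqB)
        (Subring.prod_mem _ fun i _ => hSO (s i)))
    have : G = h₀ * (q * ∏ i, algebraMap S E (s i)) := by rw [hGdef]; ring
    rw [this, map_mul]
    calc OE.valuation h₀ * OE.valuation (q * ∏ i, algebraMap S E (s i))
        ≤ OE.valuation h₀ * 1 := mul_le_mul_right h1 _
      _ < 1 := by rw [mul_one]; exact hvh₀
  -- monomialization with denominator control
  obtain ⟨t', htt', ht'K, hT'O, hreg', x, u, α, hx, huR, hvu, hG, hden⟩ :=
    hMono t htK hTO hreg G hGR hG0 hvG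
  have hRR' : locAtCentre (Algebra.adjoin S (t : Set E)).toSubring OE ≤
      locAtCentre (Algebra.adjoin S (t' : Set E)).toSubring OE :=
    locAtCentre_mono OE (Algebra.adjoin_mono (by exact_mod_cast htt'))
  -- property (1): rescale the new generators
  have hunion : (t : Set E) ∪ ↑(t' \ t) = (t' : Set E) := by
    rw [Finset.coe_sdiff, Set.union_sdiff_cancel (by exact_mod_cast htt')]
  obtain ⟨t'', htt'', ht''fin, ht''K, hEq, q', hq'A, hT'', L, c', hc', hL⟩ :=
    exists_model_tracked_of_denominators_subset OE A hsA
      (locAtCentre (Algebra.adjoin S (t' : Set E)).toSubring OE) q G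
      (le_locAtCentre _ _ hqB) K' hSK (t' \ t) (t : Set E)
      t.finite_toSet htK (fun z hz => ht'K ((Finset.mem_sdiff.mp hz).1))
      hAR (by rw [hunion]) q (le_locAtCentre _ _ hqB)
      (fun w hw => ⟨1, by rw [pow_one]; exact le_locAtCentre _ _ (hqt w hw)⟩)
      ⟨1, G, hRR' hGR, by rw [pow_one]⟩
      (fun z hz => by
        obtain ⟨a, b, ha, hb, ha0, hzab, N, c, hc, hN⟩ := hden z (Finset.mem_sdiff.mp hz).1
        exact ⟨a, b, ha, hb, ha0, hzab, N, c, hc, hN⟩)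
  rw [hunion] at hEq
  -- the final local ring `(locAtCentre (Algebra.adjoin S (t' : Set E)).toSubring OE) = locAtCentre S[t'] O_E`
  haveI := isLocalRing_locAtCentre hT'O
  haveI hreg'i := hreg'
  have hx0 : ∀ j, (x j : E) ≠ 0 := fun j =>
    coe_rsop_ne_zero_of_frame hSuc hinj OE hSO hdom hres hSdim' (t' : Set E) t'.finite_toSet hT'O
      hreg' x hx j
  have hdimR : ringKrullDim (locAtCentre (Algebra.adjoin S (t' : Set E)).toSubring OE) = (3 : ℕ) := by
    haveI : Algebra.FiniteType S (Algebra.adjoin S (t' : Set E)) :=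
      (Subalgebra.fg_iff_finiteType _).mp (Subalgebra.fg_adjoin_finset _)
    rw [ringKrullDim_locAtCentre_eq_of_frame hSuc hinj OE hSO hdom hres
      (Algebra.adjoin S (t' : Set E)) hT'O, hSdim']
  have hd : (maximalIdeal (locAtCentre (Algebra.adjoin S (t' : Set E)).toSubring OE)).spanFinrank = 3 := by
    have h := IsRegularLocalRing.spanFinrank_maximalIdeal (R := (locAtCentre (Algebra.adjoin S (t' : Set E)).toSubring OE))
    rw [hdimR] at h
    exact_mod_cast h
  have hprime : ∀ c, Prime (x c) := fun c => by
    have h := isPrime_span_image hd x hx {c}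
    rw [Finset.coe_singleton, Set.image_singleton] at h
    refine (Ideal.span_singleton_prime ?_).mp h
    intro h0
    exact hx0 c (by rw [h0]; rfl)
  have hval1 : ∀ w : (locAtCentre (Algebra.adjoin S (t' : Set E)).toSubring OE), IsUnit w → OE.valuation (w : E) = 1 := fun w hw => by
    by_contra hne
    have hlt : OE.valuation (w : E) < 1 :=
      lt_of_le_of_ne ((OE.valuation_le_one_iff _).mpr (locAtCentre_le hT'O w.2)) hne
    exact (not_isUnit_locAtCentre_iff hT'O w).mpr hlt hw
  have hu0 : u ≠ 0 := ne_zero_of_valuation_eq_one hvu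
  have huinv : u⁻¹ ∈ (locAtCentre (Algebra.adjoin S (t' : Set E)).toSubring OE) := inv_mem_locAtCentre huR hvu
  -- divisors of powers of `G` in the final local ring are monomials
  have hmono : ∀ y : E, y ∈ locAtCentre (Algebra.adjoin S (t' : Set E)).toSubring OE → (∃ (n : ℕ) (c : E), c ∈ locAtCentre (Algebra.adjoin S (t' : Set E)).toSubring OE ∧ G ^ n = y * c) →
      ∃ (γ : E) (a : Fin 3 → ℕ), γ ∈ locAtCentre (Algebra.adjoin S (t' : Set E)).toSubring OE ∧ OE.valuation γ = 1 ∧ y = γ * ∏ c, (x c : E) ^ a c := by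
    intro y hy ⟨n, cy, hcy, hGy⟩
    have hdvd : (⟨y, hy⟩ : locAtCentre (Algebra.adjoin S (t' : Set E)).toSubring OE) ∣ ∏ c, x c ^ (n * α c) := by
      refine ⟨⟨cy, hcy⟩ * ⟨u⁻¹, huinv⟩ ^ n, Subtype.ext ?_⟩
      simp only [Subring.coe_mul, SubmonoidClass.coe_finsetProd, SubmonoidClass.coe_pow]
      have h1 : (∏ c, (x c : E) ^ (n * α c)) = (u⁻¹) ^ n * G ^ n := by
        rw [hG, mul_pow, ← mul_assoc, ← mul_pow, inv_mul_cancel₀ hu0, one_pow, one_mul,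
          ← Finset.prod_pow]
        exact Finset.prod_congr rfl fun c _ => by rw [← pow_mul, mul_comm]
      rw [h1, hGy]; ring
    obtain ⟨γu, a, hγa⟩ :=
      CossartPiltantMonomial.exists_eq_units_mul_prod_pow_of_dvd hprime _ hdvd
    refine ⟨(γu : locAtCentre (Algebra.adjoin S (t' : Set E)).toSubring OE), a, γu.val.2, hval1 _ γu.isUnit, ?_⟩
    have := congrArg Subtype.val hγa
    simpa only [Subring.coe_mul, SubmonoidClass.coe_finsetProd, SubmonoidClass.coe_pow] using this
  -- `q'`, `h₀` divide powers of `G`, hence are monomials; `F := q' G`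
  have hq'R : q' ∈ locAtCentre (Algebra.adjoin S (t' : Set E)).toSubring OE := hRR' (hAR hq'A)
  have hh₀R : h₀ ∈ locAtCentre (Algebra.adjoin S (t' : Set E)).toSubring OE := hRR' (hAR (le_locAtCentre _ _ hh₀B))
  have hqR : q ∈ locAtCentre (Algebra.adjoin S (t' : Set E)).toSubring OE := hRR' (hAR (le_locAtCentre _ _ hqB))
  have hsR : ∀ i, algebraMap S E (s i) ∈ locAtCentre (Algebra.adjoin S (t' : Set E)).toSubring OE := fun i =>
    le_locAtCentre _ _ ((Algebra.adjoin S (t' : Set E)).algebraMap_mem _)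
  have hprodR : (∏ i, algebraMap S E (s i)) ∈ locAtCentre (Algebra.adjoin S (t' : Set E)).toSubring OE := Subring.prod_mem _ fun i _ => hsR i
  have hGG : G * G = (q * G) * (h₀ * ∏ i, algebraMap S E (s i)) := by rw [hGdef]; ring
  have hG2L : G ^ (2 * L) = q' * (c' * (h₀ * ∏ i, algebraMap S E (s i)) ^ L) := by
    rw [pow_mul, sq, hGG, mul_pow, hL]; ring
  obtain ⟨γq, aq, hγqR, hvγq, hq'mono⟩ := hmono q' hq'R ⟨2 * L, _,
    Subring.mul_mem _ hc' (Subring.pow_mem _ (Subring.mul_mem _ hh₀R hprodR) _), hG2L⟩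
  obtain ⟨w₀, β, hw₀R, hvw₀, hh₀mono⟩ := hmono h₀ hh₀R ⟨1, q * ∏ i, algebraMap S E (s i),
    Subring.mul_mem _ hqR hprodR, by rw [pow_one, hGdef]; ring⟩
  -- the tracked monomial `F := q' G` and the monomial `h₀`
  set F : E := q' * G with hFdef
  have hFA : F ∈ A := A.mul_mem hq'A hGA
  have hFmono : F = (γq * u) * ∏ c, (x c : E) ^ (aq c + α c) := by
    rw [hFdef, hq'mono, hG]
    simp only [pow_add, Finset.prod_mul_distrib]
    ring
  have hγquR : γq * u ∈ locAtCentre (Algebra.adjoin S (t' : Set E)).toSubring OE := Subring.mul_mem _ hγqR huR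
  have hvγqu : OE.valuation (γq * u) = 1 := by rw [map_mul, hvγq, hvu, one_mul]
  have hTRF : ∀ z ∈ t'', ∃ n : ℕ, F ^ n * z ∈ A := fun z hz => by
    obtain ⟨n, hn⟩ := hT'' z hz
    refine ⟨n, ?_⟩
    rw [hFdef, mul_pow, mul_comm (q' ^ n), mul_assoc]
    exact A.mul_mem (A.pow_mem hGA _) hn
  have hβα : ∀ c, 0 < β c → 0 < aq c + α c := by
    intro c hc
    have hh₀' : (⟨h₀, hh₀R⟩ : locAtCentre (Algebra.adjoin S (t' : Set E)).toSubring OE) = ⟨w₀, hw₀R⟩ * ∏ k, x k ^ β k :=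
      Subtype.ext (by
        simp only [Subring.coe_mul, SubmonoidClass.coe_finsetProd, SubmonoidClass.coe_pow]
        exact hh₀mono)
    have hxh₀ : x c ∣ (⟨h₀, hh₀R⟩ : locAtCentre (Algebra.adjoin S (t' : Set E)).toSubring OE) := by
      rw [hh₀']
      exact Dvd.dvd.mul_left ((dvd_pow_self (x c) hc.ne').trans
        (Finset.dvd_prod_of_mem (fun k => x k ^ β k) (Finset.mem_univ c))) _
    have hxF : x c ∣ (⟨γq * u, hγquR⟩ : locAtCentre (Algebra.adjoin S (t' : Set E)).toSubring OE) * ∏ k, x k ^ (aq k + α k) := by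
      have h1 : (⟨h₀, hh₀R⟩ : locAtCentre (Algebra.adjoin S (t' : Set E)).toSubring OE) ∣ ⟨γq * u, hγquR⟩ * ∏ k, x k ^ (aq k + α k) := by
        refine ⟨⟨q' * (q * ∏ i, algebraMap S E (s i)), Subring.mul_mem _ hq'R
          (Subring.mul_mem _ hqR hprodR)⟩, Subtype.ext ?_⟩
        simp only [Subring.coe_mul, SubmonoidClass.coe_finsetProd, SubmonoidClass.coe_pow]
        rw [← hFmono, hFdef, hGdef]; ring
      exact hxh₀.trans h1
    exact pos_of_rsop_dvd_monomial hSuc hinj OE hSO hdom hres hSdim' (t' : Set E) t'.finite_toSet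
      hT'O hreg' x hx ⟨γq * u, hγquR⟩ hvγqu _ c hxF
  have hβne : ∃ c, 0 < β c := by
    by_contra hnone
    push Not at hnone
    have hβ0 : ∀ c, β c = 0 := fun c => Nat.eq_zero_of_le_zero (hnone c)
    have : h₀ = w₀ := by
      rw [hh₀mono]
      simp only [hβ0, pow_zero, Finset.prod_const_one, mul_one]
    rw [this, hvw₀] at hvh₀
    exact lt_irrefl _ hvh₀
  have hfdvd : ∀ i, ∃ c ∈ locAtCentre (Algebra.adjoin S (t' : Set E)).toSubring OE, F = algebraMap S E (s i) * c := by
    intro i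
    refine ⟨q' * q * h₀ * ∏ j ∈ Finset.univ.erase i, algebraMap S E (s j),
      Subring.mul_mem _ (Subring.mul_mem _ (Subring.mul_mem _ hq'R hqR) hh₀R)
        (Subring.prod_mem _ fun j _ => hsR j), ?_⟩
    rw [hFdef, hGdef, ← Finset.mul_prod_erase _ _ (Finset.mem_univ i)]
    ring
  -- transport everything to the rescaled model `S[t'']`
  have hT''O : (Algebra.adjoin S t'').toSubring ≤ OE.toSubring := by
    refine model_toSubring_le_valuationSubring OE hSO fun z hz => ?_
    have : z ∈ locAtCentre (Algebra.adjoin S t'').toSubring OE :=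
      le_locAtCentre _ _ (Algebra.subset_adjoin hz)
    rw [hEq] at this
    exact locAtCentre_le hT'O this
  obtain ⟨x'', hx''E, hx''span⟩ := transport_rsop' OE hT'O hT''O hEq.symm x hx
  have hreg'' : IsRegularLocalRing (locAtCentre (Algebra.adjoin S t'').toSubring OE) := by
    rw [hEq]; exact hreg'
  have hmem : ∀ {y : E}, y ∈ locAtCentre (Algebra.adjoin S (t' : Set E)).toSubring OE → y ∈ locAtCentre (Algebra.adjoin S t'').toSubring OE :=
    fun hy => by rw [hEq]; exact hy
  have hB₀t'' : B₀ ≤ Algebra.adjoin S t'' :=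
    hB₀t.trans (Algebra.adjoin_mono htt'')
  exact head_conclusion_of_principalized hSuc hinj OE hSO hdom hres hSdim' hrk A hsA M K' hSK B₀ t''
    ht''fin ht''K hT''O hB₀t'' hreg'' x'' hx''span F
    (γq * u) hFA (hmem hγquR) hvγqu (fun c => aq c + α c) (by simp only [hx''E]; exact hFmono)
    hTRF h₀ w₀ (hmem hw₀R) hvw₀ β (by simp only [hx''E]; exact hh₀mono) hβα hβne
    (fun y hy hvy => by
      obtain ⟨c, hc, hyc⟩ := hdom₀ y hy hvy
      exact ⟨c, hmem (hRR' hc), hyc⟩)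
    r hr0 (hdep 3) (fun i => algebraMap S E (s i)) (fun i => hSM _)
    (fun i => hmem (hsR i))
    (fun i => by
      obtain ⟨c, hc, hFc⟩ := hfdvd i
      exact ⟨c, hmem hc, hFc⟩)
    hind

end HeadOfGlue

end Literature.AlgebraicGeometry.Resolution

end
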